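import Summits.BirchSwinnertonDyer.Rank1Residual.X5.TwoAdicTargetsMultAuto
import Summits.BirchSwinnertonDyer.Rank1Residual.X5.TwoAdicTargetsSplitAuto
import HarnessLib

/-!
# Class O1 (X5, `p = 2`, non-CM): Kato's `⊗ℚ` divisibility at a MULTIPLICATIVE prime, typed for EVERY
# prime `p` (both signs), and the multiplicative-at-`2` END doors fed by this ONE binder

HONEST FRAMING (cell `bsd-2adic`, run/shared/lean/pub/bsd-2adic/, FULL-BSD rank ≤ 1 programme
tranche 1b, D-0036; seat `bsd-2adic-mult`): research routes; no claim beyond the stated classes;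
nothing here is booked; no mark of RESIDUAL-MAP §I moves. ONE typed target (`@[conjecture] def`,
Summits-side, nothing asserted) + bookkeeping theorems; 0 named facts.

* **`O1.KatoMultiplicativeDivisibilityRat W p` (`@[conjecture]`)** — the prime-uniform statement of
  the seat's proof memo `HOME/mult/PROOF-MULT.md` (Theorems A/B there), in the tree's currency: for
  `E/ℚ` (globally minimal `W`) with multiplicative reduction at the prime `p`, the cyclotomic
  `ℤ_p`-extension with a matching generator, the newform `f` and every dual datum `D` of
  `Sel_{p^∞}(E/ℚ_∞)`: `X` is `Λ`-torsion, and (non-split, `a_p = -1`) `ι g = pⁿ · L` for some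
  `g ∈ char_Λ X`, some `n`, for every `L` with `IsMultPAdicLFunctionOf f p (-1) L`; (split, `a_p = 1`)
  `ι(T · g) = pⁿ · L` likewise for every `L` with `IsSplitMultPAdicLFunctionOf f p L` — the trivial
  zero charged to the local cohomology at `p`, never to `X` (odd-`p` shape in print: Wuthrich 2014
  Thm. 16 / Cor. 19 "`I · char X ∣ (L_p)`"; Kobayashi 2006 Thm. 4.1). NO image hypothesis, NO
  semistability-away-from-`p` hypothesis. STATUS: the memo PROVES this for every prime `p`
  including `p = 2` (Kato, Astérisque 295, 17.13 read `⊗ ℚ` with Lemma 17.12 — Coleman power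
  series — replaced by a rank/torsion count of `𝐇¹_Iw(ℚ_p, ℤ_p(φ)(1))` and Perrin-Riou's
  interpolation factor `(1 - α⁻¹)` at `κ¹`, Kato 16.4 (ii); the split factor from
  `log_p q_E ≠ 0`, Barré-Sirieix–Diaz–Gramain–Philibert), PENDING the cell referee's verdict; until a
  PASS is converted by the planner it stays a `@[conjecture]` def here, exactly like K11a / K11b-Rat.
  In print at odd `p` only under extra hypotheses (Skinner 2016 Thm. A: `p ≥ 3`, (irr), (ram);
  Wuthrich 2014 Cor. 19: semistable, odd `p`); NOT in print at `p = 2`.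
* `katoDivisibilityAtTwoNonsplitMultRat_of_multRat`, `katoDivisibilityAtTwoSplitMultRat_of_multRat`
  (PROVED): at `p = 2` the binder projects onto K11a `O1.KatoDivisibilityAtTwoNonsplitMultRat W f L`
  (`X5/TwoAdicTargetsMultEndAlpha.lean`) and K11b-Rat `O1.KatoDivisibilityAtTwoSplitMultRat W f L`
  (`X5/TwoAdicTargetsSplitEnd.lean`) for every `f`, `L`.
* The four multiplicative-at-`2` END doors of `X5/TwoAdicTargetsMultAuto.lean` /
  `X5/TwoAdicTargetsSplitAuto.lean` restated with `hK` fed by the single binder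
  (`…_of_multRat`, PROVED): per pair `BSDp W 2` ⟸ PRINT {Prop. 5.14 / Greenberg's displays at `2`,
  modularity, GZK} + `KatoMultiplicativeDivisibilityRat W 2` + DATA {`hper₀`, `hκ₁` (split), `μ = 0`
  off the 5.14 locus} + `hlow`.

References: [Kato2004Asterisque] Thm. 12.4, 12.5, 13.4 (2), (14.9.3), 16.2–16.6, 17.13;
[Wuthrich2014] Thm. 16, Cor. 19; [Kobayashi2006DocMath] Thm. 4.1; [Skinner2016PacificMC] Thm. A;
[MazurTateTeitelbaum1986Invent] §I.10, §I.14; [BarreSirieixDiazGramainPhilibert1996Manin] Thm. 1.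
-/

set_option autoImplicit false

noncomputable section

open scoped Classical MatrixGroups ModularForm

open CongruenceSubgroup WeierstrassCurve Literature.NumberTheory.EllipticCurves
  Literature.NumberTheory.EllipticCurves.ModularForms
  Literature.NumberTheory.EllipticCurves.Greenberg1999
  Literature.NumberTheory.EllipticCurves.Rank1Residual
  Literature.NumberTheory.EllipticCurves.Rank1Residual.Typed

namespace Summit.BirchSwinnertonDyer.Rank1Residual.X5.O1

variable (W : WeierstrassCurve ℚ) [W.IsElliptic] [W.IsGloballyMinimal]

/-! ## §1 The prime-uniform typed statement -/

/-- **Kato's `⊗ℚ` divisibility at a prime `p` of MULTIPLICATIVE reduction, both signs (typed for every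
prime `p`; the seat's memo `HOME/mult/PROOF-MULT.md` Thm. A/B proves it for every `p` including
`p = 2`, pending the cell referee).** For `E/ℚ` (globally minimal `W`) with `p ‖ N`, the cyclotomic
`ℤ_p`-extension `κ` with topological generator `γ` matching the cyclotomic variable, a newform `f`
of `W` (any level), and a dual datum `D` of `Sel_{p^∞}(E/ℚ_∞)`: `X` is `Λ`-torsion, and
(i) if the reduction is NON-split (`a_p = -1`): for every `L` with `IsMultPAdicLFunctionOf f p (-1) L`
there are `n` and `g ∈ char_Λ X` with `ι g = pⁿ · L` (Kato 17.4 (1)(2) shape: `char X ∣ L_p` in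
`Λ[1/p]`); (ii) if SPLIT (`a_p = 1`): for every `L` with `IsSplitMultPAdicLFunctionOf f p L` there are
`n` and `g ∈ char_Λ X` with `ι(T · g) = pⁿ · L` (`T · char X ∣ L_p` in `Λ[1/p]`: the trivial zero of
`L_p` is accounted for by the local cohomology at `p` because `log_p q_E ≠ 0`). In print at odd `p`
under extra hypotheses only (Skinner 2016 Thm. A; Wuthrich 2014 Cor. 19; Kobayashi 2006 Thm. 4.1);
not in print at `p = 2`. A TARGET; nothing asserted.
[cite: Kato2004Asterisque, Thm. 17.4 (1)(2) (p. 273) and 17.13 (pp. 279–280) (shape; p ∤ N in print)]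
[cite: Wuthrich2014, Thm. 16 and Cor. 19 (p. 398; odd p, semistable)]
[cite: Skinner2016PacificMC, Thm. A (§1; p ≥ 3, (irr), (ram))] -/
@[conjecture] def KatoMultiplicativeDivisibilityRat (p : ℕ) [Fact p.Prime] : Prop :=
  ∀ (κ : ZpExtension ℚ p) (γ : Field.absoluteGaloisGroup ℚ), κ.IsCyclotomic →
    κ.IsTopGenerator γ → IsCyclotomicVariable p γ → Mult W p →
    ∀ ⦃N : ℕ⦄ [NeZero N] (f : CuspForm (Gamma0 N) 2), IsNewformOf W f →
    ∀ D : W.SelmerDualData κ γ, D.IsTorsion ∧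
      (¬ W.HasSplitMultiplicativeReductionAtPrime p →
        ∀ L : PowerSeries ℚ_[p], IsMultPAdicLFunctionOf f p (-1) L →
          ∃ (n : ℕ) (g : IwasawaAlgebra p), g ∈ D.charIdeal ∧
            iwasawaToPowerSeries p g = PowerSeries.C ((p : ℚ_[p]) ^ n) * L) ∧
      (W.HasSplitMultiplicativeReductionAtPrime p →
        ∀ L : PowerSeries ℚ_[p], IsSplitMultPAdicLFunctionOf f p L →
          ∃ (n : ℕ) (g : IwasawaAlgebra p), g ∈ D.charIdeal ∧
            iwasawaToPowerSeries p (PowerSeries.X * g) = PowerSeries.C ((p : ℚ_[p]) ^ n) * L)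

omit [W.IsElliptic] [W.IsGloballyMinimal] in
/-- Off the multiplicative locus the target holds VACUOUSLY (its guard `Mult W p`). [folklore] -/
theorem katoMultiplicativeDivisibilityRat_of_not_mult (p : ℕ) [Fact p.Prime] (h : ¬ Mult W p) :
    KatoMultiplicativeDivisibilityRat W p :=
  fun _ _ _ _ _ hm => absurd hm h

/-! ## §2 Projections at `p = 2` onto K11a and K11b-Rat -/

omit [W.IsElliptic] [W.IsGloballyMinimal] in
/-- **K11a from the prime-uniform binder**: `KatoMultiplicativeDivisibilityRat W 2` implies
`O1.KatoDivisibilityAtTwoNonsplitMultRat W f L` for every newform `f` of `W` and every `L`.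
Bookkeeping (the non-split clause, `((2 : ℕ) : ℚ_2) = 2`). [folklore] -/
theorem katoDivisibilityAtTwoNonsplitMultRat_of_multRat (h : KatoMultiplicativeDivisibilityRat W 2)
    {N : ℕ} [NeZero N] (f : CuspForm (Gamma0 N) 2) (L : PowerSeries ℚ_[2]) :
    KatoDivisibilityAtTwoNonsplitMultRat W f L := by
  intro κ γ hκ hγ hγ' hmult hns hf hL D
  obtain ⟨hX, hnon, -⟩ := h κ γ hκ hγ hγ' hmult f hf D
  obtain ⟨n, g, hg, hι⟩ := hnon hns L hL
  refine ⟨hX, n, g, hg, ?_⟩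
  rw [hι, Nat.cast_ofNat]

omit [W.IsElliptic] [W.IsGloballyMinimal] in
/-- **K11b-Rat from the prime-uniform binder**: `KatoMultiplicativeDivisibilityRat W 2` implies
`O1.KatoDivisibilityAtTwoSplitMultRat W f L` for every newform `f` of `W` and every `L`.
Bookkeeping (the split clause). [folklore] -/
theorem katoDivisibilityAtTwoSplitMultRat_of_multRat (h : KatoMultiplicativeDivisibilityRat W 2)
    {N : ℕ} [NeZero N] (f : CuspForm (Gamma0 N) 2) (L : PowerSeries ℚ_[2]) :
    KatoDivisibilityAtTwoSplitMultRat W f L := by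
  intro κ γ hκ hγ hγ' hmult hsp hf hL D
  obtain ⟨hX, -, hspl⟩ := h κ γ hκ hγ hγ' hmult f hf D
  obtain ⟨n, g, hg, hι⟩ := hspl hsp L hL
  refine ⟨hX, n, g, hg, ?_⟩
  rw [hι, Nat.cast_ofNat]

/-! ## §3 The multiplicative-at-`2` END doors with the single binder -/

/-- **α-ns END-STATE per pair from the prime-uniform binder (PROVED):** at a NON-SPLIT multiplicative
`2`, analytic rank `0`, on the Prop. 5.14 locus: `BSDp W 2` ⟸ PRINT {`h514`, `h41`, modularity, GZK}
+ `KatoMultiplicativeDivisibilityRat W 2` + the decidable 5.14 data + `hper₀` + `hlow`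
(`bsdp_two_nonsplit_of_prop514_of_lowerBound_auto` with `hK` supplied by
`katoDivisibilityAtTwoNonsplitMultRat_of_multRat`). [cite: GreenbergLNM1716, Prop. 5.14 (p. 121) and §4 pp. 112–113]
[cite: Miller2011LMS, Def. 1.1 and §1] -/
theorem bsdp_two_nonsplit_of_prop514_of_lowerBound_of_multRat
    (hKato : KatoMultiplicativeDivisibilityRat W 2)
    (h514 : prop514_isTorsion_mu_eq_zero_two)
    (h41 : thm41Analogue_charValue_rankZero_numberField_anyPrime)
    (hmod : nonempty_modularParametrizationData)
    (hGZK : rank_eq_analyticRank_of_analyticRank_le_one)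
    (hper₀ : ∀ [NeZero (W.conductorNorm ℤ)] (f : CuspForm (Gamma0 (W.conductorNorm ℤ)) 2),
      IsNewformOf W f → ∀ ϖ : ℚ, (ϖ : ℝ) * W.realPeriodRat = plusPeriod f → 0 ≤ padicValRat 2 ϖ)
    (hr : W.analyticRank = 0) (hmult : Mult W 2) (hns : ¬ W.HasSplitMultiplicativeReductionAtPrime 2)
    {x y : ℚ} (hP : W.toAffine.Equation x y) (h2 : 2 * y + W.a₁ * x + W.a₃ = 0)
    (hΦ : (TwoTorsionRamifiedAtTwo x ∧ ¬ TwoTorsionOdd W x) ∨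
      (TwoTorsionOdd W x ∧ ¬ TwoTorsionRamifiedAtTwo x))
    (hlow : MissingLowerBoundAt W 2) : BSDp W 2 :=
  bsdp_two_nonsplit_of_prop514_of_lowerBound_auto W h514 h41 hmod hGZK
    (fun f L => katoDivisibilityAtTwoNonsplitMultRat_of_multRat W hKato f L) hper₀ hr hmult hns hP
    h2 hΦ hlow

/-- **O1-A-ns END-STATE per pair from the prime-uniform binder and a `μ = 0` certificate (PROVED):**
non-split multiplicative `2`, analytic rank `0`: `BSDp W 2` ⟸ PRINT {`h41`, modularity, GZK} +
`KatoMultiplicativeDivisibilityRat W 2` + `hμ` + `hper₀` + `hlow`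
(`bsdp_two_nonsplit_of_mu_eq_zero_of_lowerBound_auto`). [cite: GreenbergLNM1716, §4 pp. 112–113]
[cite: Miller2011LMS, Def. 1.1 and §1] -/
theorem bsdp_two_nonsplit_of_mu_eq_zero_of_lowerBound_of_multRat
    (hKato : KatoMultiplicativeDivisibilityRat W 2)
    (h41 : thm41Analogue_charValue_rankZero_numberField_anyPrime)
    (hmod : nonempty_modularParametrizationData)
    (hGZK : rank_eq_analyticRank_of_analyticRank_le_one)
    (hμ : ∀ (κ : ZpExtension ℚ 2) (γ : Field.absoluteGaloisGroup ℚ), κ.IsCyclotomic →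
      κ.IsTopGenerator γ → IsCyclotomicVariable 2 γ → ∀ D : W.SelmerDualData κ γ, D.mu = 0)
    (hper₀ : ∀ [NeZero (W.conductorNorm ℤ)] (f : CuspForm (Gamma0 (W.conductorNorm ℤ)) 2),
      IsNewformOf W f → ∀ ϖ : ℚ, (ϖ : ℝ) * W.realPeriodRat = plusPeriod f → 0 ≤ padicValRat 2 ϖ)
    (hr : W.analyticRank = 0) (hmult : Mult W 2) (hns : ¬ W.HasSplitMultiplicativeReductionAtPrime 2)
    (hlow : MissingLowerBoundAt W 2) : BSDp W 2 :=
  bsdp_two_nonsplit_of_mu_eq_zero_of_lowerBound_auto W h41 hmod hGZK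
    (fun f L => katoDivisibilityAtTwoNonsplitMultRat_of_multRat W hKato f L) hμ hper₀ hr hmult hns
    hlow

/-- **α-sp END-STATE per pair from the prime-uniform binder (PROVED):** SPLIT multiplicative `2`,
analytic rank `0`, Prop. 5.14 locus: `BSDp W 2` ⟸ PRINT {`h514`, A236 `h41`, modularity, GZK} +
`KatoMultiplicativeDivisibilityRat W 2` + the 5.14 data + `hκ₁` + `hper₀` + `hlow`
(`bsdp_two_split_of_prop514_of_lowerBound_auto`). [cite: GreenbergLNM1716, Prop. 5.14 (p. 121) and §4 pp. 112–113]
[cite: Miller2011LMS, Def. 1.1 and §1] -/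
theorem bsdp_two_split_of_prop514_of_lowerBound_of_multRat
    (hKato : KatoMultiplicativeDivisibilityRat W 2)
    (h514 : prop514_isTorsion_mu_eq_zero_two)
    (h41 : thm41Analogue_charValue_rankZero_split_baseChange_anyPrime)
    (hmod : nonempty_modularParametrizationData)
    (hGZK : rank_eq_analyticRank_of_analyticRank_le_one)
    (hκ₁ : ∀ [NeZero (W.conductorNorm ℤ)] (f : CuspForm (Gamma0 (W.conductorNorm ℤ)) 2),
      IsNewformOf W f → ∀ L : PowerSeries ℚ_[2], IsSplitMultPAdicLFunctionOf f 2 L →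
      ∀ Dq : TateParameterData W 2, PowerSeries.coeff 1 L ≠ 0 ∧
        (PowerSeries.coeff 1 L).valuation ≤
          padicValRat 2 (ratPlusSymbol f 0) + ((LInvariant Dq).valuation - 2))
    (hper₀ : ∀ [NeZero (W.conductorNorm ℤ)] (f : CuspForm (Gamma0 (W.conductorNorm ℤ)) 2),
      IsNewformOf W f → ∀ ϖ : ℚ, (ϖ : ℝ) * W.realPeriodRat = plusPeriod f → 0 ≤ padicValRat 2 ϖ)
    (hr : W.analyticRank = 0) (hmult : Mult W 2) (hsp : W.HasSplitMultiplicativeReductionAtPrime 2)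
    {x y : ℚ} (hP : W.toAffine.Equation x y) (h2 : 2 * y + W.a₁ * x + W.a₃ = 0)
    (hΦ : (TwoTorsionRamifiedAtTwo x ∧ ¬ TwoTorsionOdd W x) ∨
      (TwoTorsionOdd W x ∧ ¬ TwoTorsionRamifiedAtTwo x))
    (hlow : MissingLowerBoundAt W 2) : BSDp W 2 :=
  bsdp_two_split_of_prop514_of_lowerBound_auto W h514 h41 hmod hGZK
    (fun f L => katoDivisibilityAtTwoSplitMultRat_of_multRat W hKato f L) hκ₁ hper₀ hr hmult hsp hP
    h2 hΦ hlow

/-- **O1-A-sp END-STATE per pair from the prime-uniform binder and a `μ = 0` certificate (PROVED):**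
split multiplicative `2`, analytic rank `0`: `BSDp W 2` ⟸ PRINT {A236 `h41`, modularity, GZK} +
`KatoMultiplicativeDivisibilityRat W 2` + `hμ` + `hκ₁` + `hper₀` + `hlow`
(`bsdp_two_split_of_mu_eq_zero_of_lowerBound_auto`). [cite: GreenbergLNM1716, §4 pp. 112–113]
[cite: Miller2011LMS, Def. 1.1 and §1] -/
theorem bsdp_two_split_of_mu_eq_zero_of_lowerBound_of_multRat
    (hKato : KatoMultiplicativeDivisibilityRat W 2)
    (h41 : thm41Analogue_charValue_rankZero_split_baseChange_anyPrime)
    (hmod : nonempty_modularParametrizationData)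
    (hGZK : rank_eq_analyticRank_of_analyticRank_le_one)
    (hμ : ∀ (κ : ZpExtension ℚ 2) (γ : Field.absoluteGaloisGroup ℚ), κ.IsCyclotomic →
      κ.IsTopGenerator γ → IsCyclotomicVariable 2 γ → ∀ D : W.SelmerDualData κ γ, D.mu = 0)
    (hκ₁ : ∀ [NeZero (W.conductorNorm ℤ)] (f : CuspForm (Gamma0 (W.conductorNorm ℤ)) 2),
      IsNewformOf W f → ∀ L : PowerSeries ℚ_[2], IsSplitMultPAdicLFunctionOf f 2 L →
      ∀ Dq : TateParameterData W 2, PowerSeries.coeff 1 L ≠ 0 ∧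
        (PowerSeries.coeff 1 L).valuation ≤
          padicValRat 2 (ratPlusSymbol f 0) + ((LInvariant Dq).valuation - 2))
    (hper₀ : ∀ [NeZero (W.conductorNorm ℤ)] (f : CuspForm (Gamma0 (W.conductorNorm ℤ)) 2),
      IsNewformOf W f → ∀ ϖ : ℚ, (ϖ : ℝ) * W.realPeriodRat = plusPeriod f → 0 ≤ padicValRat 2 ϖ)
    (hr : W.analyticRank = 0) (hmult : Mult W 2) (hsp : W.HasSplitMultiplicativeReductionAtPrime 2)
    (hlow : MissingLowerBoundAt W 2) : BSDp W 2 :=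
  bsdp_two_split_of_mu_eq_zero_of_lowerBound_auto W h41 hmod hGZK
    (fun f L => katoDivisibilityAtTwoSplitMultRat_of_multRat W hKato f L) hμ hκ₁ hper₀ hr hmult hsp
    hlow

end Summit.BirchSwinnertonDyer.Rank1Residual.X5.O1

end
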